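import Mathlib.Analysis.SpecialFunctions.Gaussian.GaussianIntegral
import Literature.MathematicalPhysics.KineticTheory.InfiniteChainSeveredGibbs
import HarnessLib

/-!
# Gaussian tails of the momenta in a Gibbs state of the chain (LLL 1977, §4 remark (ii))

Lanford–Lebowitz–Lieb 1977, §4, remark (ii) (p. 459): "with respect to any Gibbs state, the `p_i`
are independent, identically distributed, Gaussian random variables of mean zero". What the proof
of Theorem 3 uses is the consequence `∫ B dμ < ∞` for `B = sup_i |p_i| / [log₊ i]^{1/2}`, and for
that only the (uniform in `i`) Gaussian **tail** of each `p_i` is needed. This file proves it from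
the DLR equation in the single site `Λ = {i}`:

* `hamiltonianIn_singleton` — `H_{{i}}(σ) = ½p_i² + U(q_i) + V(q_{i+1} - q_i) + V(q_i - q_{i-1})`;
* `lintegral_glueWith_singleton`, `integral_glueWith_singleton` — the a priori measure of the
  one-site kernel is Lebesgue measure `dq_i dp_i` (transport along `MeasurableEquiv.piUnique`);
* `chainSpecification_singleton_abs_snd_gt_le` — for every boundary condition `η` and `c ≥ 0`,
  `γ_{{i}}(|p_i| > c | η) ≤ √2 · exp(-c²/(4T))` (Fubini on `ℝ × ℝ`: the `p_i`-marginal of the kernel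
  is the centred Gaussian of variance `T` whenever the kernel is normalisable, and the kernel is `0`
  otherwise; the bound `∫_{|p|>c} e^{-p²/2T} ≤ e^{-c²/4T} ∫ e^{-p²/4T}` and `integral_gaussian`);
* `measure_abs_snd_gt_le_of_isChainGibbsMeasure` — the same bound for `μ(|p_i| > c)`, `μ` any Gibbs
  state, uniformly in `i` (DLR). [cite: LanfordLebowitzLieb1977, §4 remark (ii)]
-/

noncomputable section

open MeasureTheory Filter Topology Set Real Literature.Probability.LatticeModels
open scoped ENNReal

namespace Literature.MathematicalPhysics.KineticTheory.HeatConduction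

namespace OscillatorChain

variable (P : OscillatorChain)

/-! ### The one-site kernel -/

omit P in
/-- The site type of a singleton region has a unique element. [folklore] -/
abbrev uniqueMemSingleton (i : ℤ) : Unique (↥({i} : Finset ℤ)) where
  default := ⟨i, Finset.mem_singleton_self i⟩
  uniq := fun ⟨_, hj⟩ => Subtype.ext (Finset.mem_singleton.1 hj)

attribute [local instance] uniqueMemSingleton

/-- **The one-site Hamiltonian** `H_{{i}}(σ) = ½ p_i² + U(q_i) + V(q_{i+1} - q_i) + V(q_i - q_{i-1})`
(LLL (10) for `Λ = {i}`). [cite: LanfordLebowitzLieb1977, §2 eq. (10)] -/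
theorem hamiltonianIn_singleton (i : ℤ) (σ : ChainConfig) :
    hamiltonianIn P.chainPotential chainSupp {i} σ =
      (σ i).2 ^ 2 / 2 + P.U (σ i).1 +
        (P.V ((σ (i + 1)).1 - (σ i).1) + P.V ((σ i).1 - (σ (i - 1)).1)) := by
  rw [hamiltonianIn_chain, Finset.sum_singleton]
  have hb : bondSet {i} = insert i {i - 1} := by
    rw [bondSet, Finset.image_singleton, Finset.insert_eq]
  have hi : i ∉ ({i - 1} : Finset ℤ) := by rw [Finset.mem_singleton]; omega
  rw [hb, Finset.sum_insert hi, Finset.sum_singleton, sub_add_cancel]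

omit P in
/-- Gluing a one-site datum is updating the configuration at that site. [folklore] -/
theorem glueWith_singleton (i : ℤ) (ζ : ↥({i} : Finset ℤ) → ℝ × ℝ) (η : ChainConfig) :
    glueWith {i} ζ η = Function.update η i (ζ default) := by
  funext j
  by_cases hj : j = i
  · subst hj
    rw [glueWith_apply_mem {j} ζ η (Finset.mem_singleton_self j), Function.update_self]
    rfl
  · rw [glueWith_apply_not_mem {i} ζ η (by simpa using hj), Function.update_of_ne hj]

omit P in
/-- **The a priori measure of the one-site kernel is `dq_i dp_i`** (Lebesgue integrals).
[folklore] -/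
theorem lintegral_glueWith_singleton (i : ℤ) (η : ChainConfig) {G : ChainConfig → ℝ≥0∞}
    (hG : Measurable G) :
    ∫⁻ ζ, G (glueWith {i} ζ η) ∂(Measure.pi fun _ : ↥({i} : Finset ℤ) => (volume : Measure (ℝ × ℝ))) =
      ∫⁻ z : ℝ × ℝ, G (Function.update η i z) := by
  have hΘ := measurePreserving_piUnique (fun _ : ↥({i} : Finset ℤ) => (volume : Measure (ℝ × ℝ)))
  have hm : Measurable fun z : ℝ × ℝ => G (Function.update η i z) := hG.comp (measurable_update η)
  simp_rw [glueWith_singleton]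
  exact hΘ.lintegral_comp hm

omit P in
/-- The a priori measure of the one-site kernel is `dq_i dp_i` (Bochner integrals). [folklore] -/
theorem integral_glueWith_singleton (i : ℤ) (η : ChainConfig) (g : ChainConfig → ℝ) :
    ∫ ζ, g (glueWith {i} ζ η) ∂(Measure.pi fun _ : ↥({i} : Finset ℤ) => (volume : Measure (ℝ × ℝ))) =
      ∫ z : ℝ × ℝ, g (Function.update η i z) := by
  have hΘ := measurePreserving_piUnique (fun _ : ↥({i} : Finset ℤ) => (volume : Measure (ℝ × ℝ)))
  simp_rw [glueWith_singleton]
  exact hΘ.integral_comp' (f := MeasurableEquiv.piUnique _) (fun z : ℝ × ℝ => g (Function.update η i z))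

/-! ### Gaussian estimates -/

omit P in
/-- `√(π/(b/2)) = √2 · √(π/b)`. [folklore] -/
theorem sqrt_pi_div_half {b : ℝ} (hb : 0 < b) : √(π / (b / 2)) = √2 * √(π / b) := by
  rw [← Real.sqrt_mul (by norm_num : (0 : ℝ) ≤ 2)]
  congr 1
  field_simp

omit P in
/-- The Gaussian tail integrand is dominated: for `0 ≤ c < |p|`,
`e^{-b p²} ≤ e^{-(b/2) c²} e^{-(b/2) p²}`. [folklore] -/
theorem exp_neg_mul_sq_le {b c p : ℝ} (hb : 0 ≤ b) (hc : 0 ≤ c) (hcp : c < |p|) :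
    exp (-b * p ^ 2) ≤ exp (-(b / 2) * c ^ 2) * exp (-(b / 2) * p ^ 2) := by
  rw [← Real.exp_add]
  apply Real.exp_le_exp.2
  have h1 : c ^ 2 ≤ p ^ 2 := by
    have : |c| < |p| := by rwa [abs_of_nonneg hc]
    exact (sq_lt_sq.2 this).le
  nlinarith

/-- **Gaussian tail of `p_i` under the one-site kernel** (LLL §4 remark (ii), quantitative tail
form): for every boundary condition `η`, temperature `T > 0` and `c ≥ 0`,
`γ_{{i}}({|p_i| > c} | η) ≤ √2 · exp(-c²/(4T))`. If the kernel is not normalisable it is the zero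
measure; otherwise its `p_i`-marginal is the centred Gaussian of variance `T` (Fubini), whose tail
beyond `c` is at most `√2 e^{-c²/4T}`. [cite: LanfordLebowitzLieb1977, §4 remark (ii)] -/
theorem chainSpecification_singleton_abs_snd_gt_le {T : ℝ} (hT : 0 < T) (hUc : Continuous P.U)
    (hVc : Continuous P.V) (i : ℤ) (η : ChainConfig) {c : ℝ} (hc : 0 ≤ c) :
    P.chainSpecification T {i} η {σ | c < |(σ i).2|} ≤
      ENNReal.ofReal (√2 * exp (-(T⁻¹ / 4) * c ^ 2)) := by
  set A : Set ChainConfig := {σ | c < |(σ i).2|} with hAdef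
  have hA : MeasurableSet A :=
    measurableSet_lt measurable_const
      (continuous_abs.comp ((continuous_apply i).snd)).measurable
  set pi0 : Measure (↥({i} : Finset ℤ) → ℝ × ℝ) := Measure.pi fun _ => (volume : Measure (ℝ × ℝ))
    with hpi0
  set f : ChainConfig → ℝ := fun σ => -T⁻¹ * hamiltonianIn P.chainPotential chainSupp {i} σ with hf
  have hfm : Measurable f :=
    ((continuous_hamiltonianIn_chain P hUc hVc {i}).measurable).const_mul _
  -- the one-dimensional factors
  set b : ℝ := T⁻¹ / 2 with hb
  have hb0 : 0 < b := by positivity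
  set W : ℝ → ℝ := fun q => P.U q + (P.V ((η (i + 1)).1 - q) + P.V (q - (η (i - 1)).1)) with hW
  set a : ℝ → ℝ := fun q => exp (-T⁻¹ * W q) with ha
  set g : ℝ → ℝ := fun p => exp (-b * p ^ 2) with hg
  have hWc : Continuous W := by
    simp only [hW]; fun_prop
  have ham : Measurable a := by simp only [ha]; fun_prop
  have hgm : Measurable g := by simp only [hg]; fun_prop
  have ha0 : ∀ q, 0 < a q := fun q => Real.exp_pos _
  have hg0 : ∀ p, 0 < g p := fun p => Real.exp_pos _
  -- the density at an updated configuration factorises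
  have hi1 : i + 1 ≠ i := by omega
  have hi2 : i - 1 ≠ i := by omega
  have hexp : ∀ z : ℝ × ℝ, exp (f (Function.update η i z)) = a z.1 * g z.2 := by
    intro z
    rw [ha, hg, ← Real.exp_add]
    congr 1
    simp only [hf, hamiltonianIn_singleton, Function.update_self, Function.update_of_ne hi1,
      Function.update_of_ne hi2, hW, hb]
    ring
  -- the normaliser
  set Z : ℝ := ∫ x, exp (f x) ∂(pi0.map (glueWith {i} · η)) with hZ
  have hZ' : Z = (∫ q, a q) * ∫ p, g p := by
    rw [hZ, integral_map (measurable_glueWith _ η).aemeasurable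
      hfm.exp.aestronglyMeasurable, hpi0, integral_glueWith_singleton i η (fun σ => rexp (f σ))]
    simp_rw [hexp]
    rw [show (volume : Measure (ℝ × ℝ)) = (volume : Measure ℝ).prod volume from rfl,
      integral_prod_mul a g]
  have hG : ∫ p, g p = √(π / b) := integral_gaussian b
  have hGpos : 0 < ∫ p, g p := by rw [hG]; positivity
  -- the kernel evaluated on `A`
  have hρm : Measurable (fun σ => ENNReal.ofReal (exp (f σ) / Z)) :=
    ENNReal.measurable_ofReal.comp (hfm.exp.div_const Z)
  have hGm : Measurable (A.indicator fun σ => ENNReal.ofReal (exp (f σ) / Z)) := hρm.indicator hA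
  have hker : P.chainSpecification T {i} η A =
      ∫⁻ z : ℝ × ℝ, A.indicator (fun σ => ENNReal.ofReal (exp (f σ) / Z)) (Function.update η i z) := by
    change (pi0.map (glueWith {i} · η)).tilted f A = _
    rw [tilted_apply' _ _ hA, ← hZ, ← lintegral_indicator hA,
      lintegral_map (f := A.indicator fun σ => ENNReal.ofReal (exp (f σ) / Z)) hGm
        (measurable_glueWith _ η),
      hpi0, lintegral_glueWith_singleton i η hGm]
  rw [hker]
  by_cases hIa : ∫ q, a q = 0
  · -- non-normalisable (or degenerate) case: the kernel vanishes
    have hZ0 : Z = 0 := by rw [hZ', hIa, zero_mul]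
    have : ∀ z : ℝ × ℝ, A.indicator (fun σ => ENNReal.ofReal (exp (f σ) / Z)) (Function.update η i z) = 0 := by
      intro z
      simp [Set.indicator, hZ0]
    simp_rw [this]
    simp
  -- normalisable case
  have hIa_int : Integrable a := by
    by_contra h
    exact hIa (integral_undef h)
  have hIapos : 0 < ∫ q, a q :=
    lt_of_le_of_ne (integral_nonneg fun q => (ha0 q).le) (Ne.symm hIa)
  have hZpos : 0 < Z := by rw [hZ']; exact mul_pos hIapos hGpos
  -- pointwise domination of the integrand
  set K : ℝ := exp (-(b / 2) * c ^ 2) with hK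
  have hdom : ∀ z : ℝ × ℝ,
      A.indicator (fun σ => ENNReal.ofReal (exp (f σ) / Z)) (Function.update η i z) ≤
        ENNReal.ofReal (a z.1 / Z) * ENNReal.ofReal (K * exp (-(b / 2) * z.2 ^ 2)) := by
    intro z
    by_cases hz : Function.update η i z ∈ A
    · rw [Set.indicator_of_mem hz, hexp, ← ENNReal.ofReal_mul (by positivity)]
      apply ENNReal.ofReal_le_ofReal
      have hz' : c < |z.2| := by simpa [hAdef] using hz
      have hle := exp_neg_mul_sq_le hb0.le hc hz'
      rw [mul_div_right_comm]
      exact mul_le_mul_of_nonneg_left hle (by positivity)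
    · rw [Set.indicator_of_notMem hz]
      exact bot_le
  have hmeas1 : AEMeasurable (fun q : ℝ => ENNReal.ofReal (a q / Z)) volume :=
    (ENNReal.measurable_ofReal.comp (ham.div_const Z)).aemeasurable
  have hmeas2 : AEMeasurable (fun p : ℝ => ENNReal.ofReal (K * exp (-(b / 2) * p ^ 2))) volume := by
    refine (ENNReal.measurable_ofReal.comp ?_).aemeasurable
    fun_prop
  calc ∫⁻ z : ℝ × ℝ, A.indicator (fun σ => ENNReal.ofReal (exp (f σ) / Z)) (Function.update η i z)
      ≤ ∫⁻ z : ℝ × ℝ, ENNReal.ofReal (a z.1 / Z) * ENNReal.ofReal (K * exp (-(b / 2) * z.2 ^ 2)) :=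
        lintegral_mono hdom
    _ = (∫⁻ q : ℝ, ENNReal.ofReal (a q / Z)) * ∫⁻ p : ℝ, ENNReal.ofReal (K * exp (-(b / 2) * p ^ 2)) := by
        rw [show (volume : Measure (ℝ × ℝ)) = (volume : Measure ℝ).prod volume from rfl]
        exact lintegral_prod_mul hmeas1 hmeas2
    _ = ENNReal.ofReal (∫ q, a q / Z) * ENNReal.ofReal (∫ p, K * exp (-(b / 2) * p ^ 2)) := by
        rw [← ofReal_integral_eq_lintegral_ofReal (hIa_int.div_const Z)
            (ae_of_all _ fun q => by positivity),
          ← ofReal_integral_eq_lintegral_ofReal ((integrable_exp_neg_mul_sq (by positivity)).const_mul K)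
            (ae_of_all _ fun p => by positivity)]
    _ = ENNReal.ofReal (√2 * K) := by
        rw [← ENNReal.ofReal_mul (by positivity), integral_div, integral_const_mul,
          integral_gaussian (b / 2), sqrt_pi_div_half hb0, hZ', hG]
        congr 1
        field_simp
    _ = ENNReal.ofReal (√2 * exp (-(T⁻¹ / 4) * c ^ 2)) := by
        rw [hK, hb]
        congr 3
        ring

/-- **Gaussian tails of the momenta in any Gibbs state** (LLL 1977, §4 remark (ii)): if `μ` is a
Gibbs state of the chain at temperature `T > 0` (`U, V` continuous), then for every site `i` and
every `c ≥ 0`, `μ(|p_i| > c) ≤ √2 · exp(-c²/(4T))` — uniformly in `i` (DLR equation in `{i}` and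
`chainSpecification_singleton_abs_snd_gt_le`). [cite: LanfordLebowitzLieb1977, §4 remark (ii)] -/
theorem measure_abs_snd_gt_le_of_isChainGibbsMeasure {T : ℝ} (hT : 0 < T) (hUc : Continuous P.U)
    (hVc : Continuous P.V) {μ : Measure ChainConfig} (hμ : P.IsChainGibbsMeasure T μ) (i : ℤ)
    {c : ℝ} (hc : 0 ≤ c) :
    μ {σ | c < |(σ i).2|} ≤ ENNReal.ofReal (√2 * exp (-(T⁻¹ / 4) * c ^ 2)) := by
  haveI := hμ.1
  have hA : MeasurableSet {σ : ChainConfig | c < |(σ i).2|} :=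
    measurableSet_lt measurable_const
      (continuous_abs.comp ((continuous_apply i).snd)).measurable
  rw [← hμ.2 {i} _ hA]
  calc ∫⁻ η, P.chainSpecification T {i} η {σ | c < |(σ i).2|} ∂μ
      ≤ ∫⁻ _, ENNReal.ofReal (√2 * exp (-(T⁻¹ / 4) * c ^ 2)) ∂μ :=
        lintegral_mono fun η => P.chainSpecification_singleton_abs_snd_gt_le hT hUc hVc i η hc
    _ = ENNReal.ofReal (√2 * exp (-(T⁻¹ / 4) * c ^ 2)) := by
        rw [lintegral_const, measure_univ, mul_one]

end OscillatorChain

end Literature.MathematicalPhysics.KineticTheory.HeatConduction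

end
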